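import Summits.BirchSwinnertonDyer.Rank1Residual.GaloisImage.KatoExpStarFiniteLevel
import Literature.NumberTheory.EllipticCurves.KuriharaNumber
import Literature.NumberTheory.EllipticCurves.ModularSymbolsHeckeProofs
import Literature.NumberTheory.EllipticCurves.CuspFormTwistRatPlusSymbol
import HarnessLib

/-!
# The VALUE CLAUSE of the Kato–Kurihara dictionary at the EMPTY LEVEL, discharged from Kato's
# Euler-system fact and the (P-EXP) rider: `Λfin(loc_v κ_∅) = u · p^t · δ̃_1`
# (sub-target R1-68 "PK-6-m1"; cell `b2b-bsdres`, team n1011, seat p13 GEN 13; anatomy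
# `cells/n1011/skel/T-PORT-1-PKIM.md` v0.3 §8; ROUTE-1 §53.5–53.6, r1)

HONEST FRAMING (cell `b2b-bsdres`, run/shared/lean/b2b/bsd-rank1-residual/, verbatim in every
file): the goal of the cell is to DELETE the COMBINATION-SHAPED residual classes of the
Birch–Swinnerton-Dyer formula for ALL analytic-rank `≤ 1` elliptic curves over `ℚ` — "full BSD
formula for every rank `≤ 1` curve in class `C`" assembled STRICTLY from published theorems — so
that the rank-`≤ 1` remainder becomes exactly the CONSTRUCTION-SHAPED classes, which are TYPED
(missing-input `Prop`s), NOT attempted. This is not "finishing BSD". Team n1011: research route on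
the CONSTRUCTION-SHAPED class X4 / §I N11 (route-1 PORT `T-PORT-1`, (P-KIM)).  TOOL theorem: it
consumes the cited fact's matrix `Kato2004.ZetaBody` and the rider `KatoExpStarFiniteLevelAt` as
HYPOTHESES (`hbody`, `hfin`) and discharges ONE clause of the PORT predicate DICT3 from them; NO
Euler system is asserted to exist, no class is constructed (the class `κ₀` and its two properties
are binders — THEOREM D's output at the empty level), no named fact, no definition, no `sorry`.
Nothing is booked; no mark / label / count moves.

## What

`KatoKuriharaDictionaryThreeAt` (DICT3, PORT flag `K22-Thm3.13-PORT@3`) asserts at every Kolyvagin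
level `d` the value `Λfin(loc₃ κ_d) = u_d · 3^t · δ̃_{n(d)}`.  At the EMPTY level `d = ∅`
(`n = 1`, `δ̃_1 = [0]⁺_f = L(f,1)/Ω⁺_f`, `kuriharaNumber_one`) this is Kato's explicit reciprocity
law in `Λ`-currency, and this file PROVES it from:
* `hbody : Kato2004.ZetaBody W p f ι κ Λ c d a A z x` — (C4) `Λ_{0,∅}(z_{0,∅}) = 1 ⊗ x_{0,∅}` and
  (C5) at the trivial character of level `m = 1`: `ι(x_{0,∅}) = κ · L_{(pA)}(f,1)/Ω⁺_f · R⁻`,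
  `R⁻ = c²d²[a/A]⁻ − cd²[ac/A]⁻ − c²d[ad′/A]⁻ + cd[acd′/A]⁻` (parity cross-over (P1): the EVEN
  character sees MINUS symbols; `cuspFactor_true_one`);
* `hfin : KatoExpStarFiniteLevelAt W p k t v Λ Λfin` — clause (ii) at the tame level `r = ∅` with
  the lattice element `l = 0` (the value `x_{0,∅}` is RATIONAL: `ℚ(ζ_1) = ℚ`);
* `hNorm : ∃ u : ℚ, (u : ℝ) = κ ∧ padicValRat p u = 0` and `κ ≠ 0` (ROUTE-1 §53.5, R-κ (b));
* the depletion identity `hdepl : L_{(pA)}(f,1) = E · L(f,1)` for a rational `E` with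
  `padicValRat p E = 0`, `E ≠ 0` — DISPLAYED (the analytic identity with
  `E = ∏_{q ∣ pA} (1 − a_q q⁻¹ + 𝟙_{q∤N} q⁻¹)`, the `p`-factor being `1` at an additive `p`, is the
  brick PK-L `KatoDepletedLValue` of n1011-p02; the `p`-adic unit-ness of the `A`-factors is the
  row's E-37 / A-depletion CERTIFICATE) and the 𝔊⁻-certificate `R⁻ ≠ 0`, `padicValRat p R⁻ = 0`
  (ROW certificate (S-𝔊⁻), ROUTE-1 §45/§53.5) — displayed, never proved here;
* `[0]⁺_f = L(f,1)/Ω⁺_f` (tree: `modularSymbol_zero_eq_holds`, `ratCast_ratPlusSymbol_mul_plusPeriod`)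
  and its `p`-integrality under `Irr(E[p])`, `p` odd (`IsNewformOf.not_dvd_den_ratPlusSymbol_div`);
* the class `κ₀ ∈ H¹(ℚ, E[p^k·p])` with `res κ₀ = Ψ(z_{0,∅})` (`Ψ` any coefficient change computed
  on cocycles by `a ↦ a_{k+1}`) and `loc_v κ₀ ∈ 𝓕_can(v)` — BINDERS (in PK-6 they are THEOREM D's
  clauses at `r = ∅`, `D_∅ = 1`, and clause (0) at `v`).
Conclusion: **`∃ u ∈ (ℤ/p^{k+1})ˣ, Λfin(loc_v κ₀) = u · p^t · kuriharaNumber f (p^(k+1)) 1 ψ`** for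
every `ψ` — DICT3's value clause at `d = ∅`, with `u = (κ · E · R⁻ mod p^{k+1})`.
NOT here: the levels `d ≠ ∅` (PK-1/PK-3/PK-4, F-A/F-C, THEOREM A/B), the Manin binder `hc` and the
period transfer `hper` (unused at `d = ∅`: by D-53-3 the `ω_E`-normalisation lives inside `hNorm`'s
meaning), any unit claim about `E` or `R⁻` (row certificates).  Stated for a general prime `p`.

References: K. Kato, Astérisque 295 (2004), Thm. 6.6 (1), Thm. 9.7, Thm. 12.5 (1)
[Kato2004Asterisque]; C.-H. Kim, AJM 148 (2026) = arXiv:2203.12159, §1.4.3, Thm. 3.13 (arXiv v3;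
= Thm. 3.11 of AJM 148) [Kim2022StructureSelmer]; B. Mazur, J. Tate, J. Teitelbaum, Invent. Math. 84
(1986) §I.8 [MazurTateTeitelbaum1986Invent]; design `cells/n1011/ROUTE-1.md` §53.4–53.6 (r1),
`cells/n1011/skel/T-PORT-1-PKIM.md` v0.3 §8 (p13).
-/

noncomputable section

open scoped NumberField TensorProduct MatrixGroups
open IsDedekindDomain NumberField WeierstrassCurve CongruenceSubgroup
open Literature.NumberTheory.GaloisRepresentations
open Literature.NumberTheory.EllipticCurves Literature.NumberTheory.EllipticCurves.ModularForms
open Literature.NumberTheory.EllipticCurves.Kato2004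
open Literature.NumberTheory.EllipticCurves.Kato2004.EulerSystemValues
open Literature.NumberTheory.DiophantineGeometry.Dioph (ratModP)

namespace Summit.BirchSwinnertonDyer.Rank1Residual.GaloisImage.KatoValue

/-! ### Level one: `ℚ(ζ_1) = ℚ` -/

/-- The bottom cyclotomic level is `m(0, ∅) = 1`. [folklore] -/
theorem cycLevel_zero_empty (p : ℕ) : cycLevel p 0 ∅ = 1 := by
  simp [cycLevel]

set_option backward.isDefEq.respectTransparency false in
/-- Every element of `ℚ(ζ_1)` is rational (`[ℚ(ζ_m) : ℚ] = φ(m)`, `φ(1) = 1`). [folklore] -/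
theorem exists_algebraMap_eq_of_level_one {m : ℕ} [NeZero m] (hm : m = 1)
    (x : CyclotomicField m ℚ) : ∃ r : ℚ, algebraMap ℚ (CyclotomicField m ℚ) r = x := by
  have hfin : Module.finrank ℚ (CyclotomicField m ℚ) = 1 := by
    rw [IsCyclotomicExtension.finrank (CyclotomicField m ℚ)
      (Polynomial.cyclotomic.irreducible_rat (NeZero.pos m)), hm, Nat.totient_one]
  have hx : x ∈ (⊥ : Subalgebra ℚ (CyclotomicField m ℚ)) := by
    rw [Subalgebra.bot_eq_top_of_finrank_eq_one hfin]
    exact Algebra.mem_top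
  exact Algebra.mem_bot.mp hx

/-- A ring homomorphism `ℚ(ζ_m) → ℂ` restricts to the canonical map on `ℚ`. [folklore] -/
theorem ringHom_algebraMap {m : ℕ} [NeZero m] (ι : CyclotomicField m ℚ →+* ℂ) (r : ℚ) :
    ι (algebraMap ℚ (CyclotomicField m ℚ) r) = (r : ℂ) := by
  rw [← RingHom.comp_apply]
  exact congrFun (congrArg DFunLike.coe (Subsingleton.elim (ι.comp (algebraMap ℚ _)) (Rat.castHom ℂ))) r

set_option backward.isDefEq.respectTransparency false in
/-- At level `m = 1` Kato's character sum `Σ_b χ(b) ι(σ_b x)` is the single value `ι(x)`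
(`(ℤ/1)ˣ = {1}`, `σ_1 = id`). [folklore] -/
theorem charSum_of_level_one {m : ℕ} [NeZero m] (hm : m = 1) (ι : CyclotomicField m ℚ →+* ℂ)
    (χ : DirichletCharacter ℂ m) (x : CyclotomicField m ℚ) : charSum m ι χ x = ι x := by
  subst hm
  haveI : Subsingleton (ZMod 1) := ZMod.subsingleton_iff.mpr rfl
  haveI : Subsingleton (ZMod 1)ˣ := ⟨fun a b ↦ Units.ext (Subsingleton.elim _ _)⟩
  rw [charSum, Fintype.sum_subsingleton _ 1, Units.val_one, map_one, one_mul, sigma, map_one,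
    AlgEquiv.one_apply]

/-- A Dirichlet character of level `1` is identically `1` on `ZMod 1`. [folklore] -/
theorem dirichletCharacter_apply_of_level_one {m : ℕ} (hm : m = 1) (χ : DirichletCharacter ℂ m)
    (u : ZMod m) : χ u = 1 := by
  subst hm
  haveI : Subsingleton (ZMod 1) := ZMod.subsingleton_iff.mpr rfl
  rw [Subsingleton.elim u 1, map_one]

section Padic

variable {p : ℕ} [Fact p.Prime]

/-! ### `p`-adic bookkeeping: the premise of clause (ii) at a rational value, and the unit -/

/-- `p^n • (1 ⊗ r) = (p^n r) ⊗ 1` in `ℚ_p ⊗_ℚ K` for a rational `r` (step S7). [folklore] -/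
theorem pow_smul_one_tmul_algebraMap (K : Type) [Field K] [Algebra ℚ K] (n : ℕ) (r : ℚ) :
    ((p : ℤ_[p]) ^ n) • ((1 : ℚ_[p]) ⊗ₜ[ℚ] algebraMap ℚ K r) =
      (((p : ℚ_[p]) ^ n * (r : ℚ_[p])) ⊗ₜ[ℚ] (1 : K)) := by
  rw [Algebra.algebraMap_eq_smul_one, TensorProduct.tmul_smul, TensorProduct.smul_tmul',
    TensorProduct.smul_tmul']
  congr 1
  rw [Algebra.smul_def, Algebra.smul_def, mul_one, eq_ratCast]
  push_cast
  ring

/-- The premise of `KatoExpStarFiniteLevelAt` (ii) holds with the lattice element `l = 0` when the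
value is `1 ⊗ r`, `r ∈ ℚ`, and `s = p^n · r` (step S7). [folklore] -/
theorem premise_of_eq (K : Type) [Field K] [Algebra ℚ K] (S : Submodule ℤ_[p] (ℚ_[p] ⊗[ℚ] K))
    (n k : ℕ) (r : ℚ) (s : ℤ_[p]) (hs : (s : ℚ_[p]) = (p : ℚ_[p]) ^ n * (r : ℚ_[p])) :
    ∃ l ∈ S, ((p : ℤ_[p]) ^ n) • ((1 : ℚ_[p]) ⊗ₜ[ℚ] algebraMap ℚ K r) - ((s : ℚ_[p]) ⊗ₜ[ℚ] (1 : K)) =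
      ((p : ℤ_[p]) ^ (k + 1)) • (l : ℚ_[p] ⊗[ℚ] K) := by
  refine ⟨0, S.zero_mem, ?_⟩
  rw [pow_smul_one_tmul_algebraMap, hs, sub_self, smul_zero]

/-- `‖U‖_p = 1` for a non-zero rational of `p`-adic valuation `0`. [folklore] -/
theorem norm_ratCast_eq_one_of_padicValRat_eq_zero {U : ℚ} (hU0 : U ≠ 0) (hU : padicValRat p U = 0) :
    ‖(U : ℚ_[p])‖ = 1 := by
  rw [Padic.eq_padicNorm, padicNorm.eq_zpow_of_nonzero hU0, hU, neg_zero, zpow_zero, Rat.cast_one]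

/-- Step S8: `toZModPow (p^t · U · b) = u · p^t · ratModP b` with `u` a unit of `ℤ/p^{k+1}`, for `U`
a `p`-adic unit rational and `b` a `p`-integral rational. [folklore] -/
theorem exists_unit_toZModPow_eq (k t : ℕ) {U b : ℚ} (hU0 : U ≠ 0) (hU : padicValRat p U = 0)
    (hb : ¬ p ∣ b.den) (s : ℤ_[p]) (hs : (s : ℚ_[p]) = (p : ℚ_[p]) ^ t * ((U * b : ℚ) : ℚ_[p])) :
    ∃ u : (ZMod (p ^ (k + 1)))ˣ, PadicInt.toZModPow (k + 1) s =
      (u : ZMod (p ^ (k + 1))) * (p : ZMod (p ^ (k + 1))) ^ t * ratModP (p ^ (k + 1)) b := by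
  have hnU := norm_ratCast_eq_one_of_padicValRat_eq_zero (p := p) hU0 hU
  set xU : ℤ_[p] := ⟨(U : ℚ_[p]), hnU.le⟩ with hxU
  set xb : ℤ_[p] := ⟨(b : ℚ_[p]), Padic.norm_rat_le_one hb⟩ with hxb
  have hunit : IsUnit xU := PadicInt.isUnit_iff.mpr hnU
  have hs' : s = (p : ℤ_[p]) ^ t * xU * xb := by
    apply PadicInt.ext
    push_cast
    rw [hs, Rat.cast_mul]
    simp [xU, xb, mul_assoc]
  obtain ⟨u, hu⟩ := hunit.map (PadicInt.toZModPow (k + 1))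
  refine ⟨u, ?_⟩
  rw [hs', map_mul, map_mul, map_pow, map_natCast, ← hu, ratModP_eq_toZModPow p (k + 1) hb]
  ring


end Padic

/-! ### `L(f,1) = Ω⁺_f · [0]⁺_f` -/

/-- Step S5: `L(f,1) = Ω⁺_f · [0]⁺_f` for every entire continuation `L` of `L(f,s)`, `f` a
rational newform (`modularSymbol_zero_eq_holds` + `ratCast_ratPlusSymbol_mul_plusPeriod`).
[cite: MazurTateTeitelbaum1986Invent, §I.8 (8.6)] -/
theorem apply_one_eq_plusPeriod_mul_ratPlusSymbol {N : ℕ} [NeZero N] (f : CuspForm (Gamma0 N) 2)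
    (hf : IsNewform0 f)
    (hQ : coeffField f = ⊥) {L : ℂ → ℂ} (hL : Differentiable ℂ L)
    (hL' : ∀ s : ℂ, 2 < s.re → L s = cuspFormLSeries f s) :
    L 1 = (plusPeriod f : ℂ) * ((ratPlusSymbol f 0 : ℚ) : ℂ) := by
  have h0 : plusSymbol f 0 = modularSymbol f 0 := by
    rw [plusSymbol, neg_zero, add_self_div_two]
  rw [← modularSymbol_zero_eq_holds f hL hL', ← h0, ← ratCast_ratPlusSymbol_mul_plusPeriod f hf hQ 0,
    mul_comm]




section Value

variable {W : WeierstrassCurve ℚ} [W.IsElliptic] {p : ℕ} [Fact p.Prime]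
  [ContinuousSMul ℤ_[p] (W.tateModule p)] [Module.Free ℤ_[p] (W.tateModule p)]
  [Module.Finite ℤ_[p] (W.tateModule p)] {N : ℕ} {f : CuspForm (Gamma0 N) 2}
  {ι : (m : ℕ) → (CyclotomicField m ℚ →+* ℂ)} {κ : ℝ}
  {Λ : ∀ (k : ℕ) (r : Finset (HeightOneSpectrum (𝓞 ℚ))),
    H1 (tateRep W p) (cycSubgroup p k r) →ₗ[ℤ_[p]] ℚ_[p] ⊗[ℚ] CyclotomicField (cycLevel p k r) ℚ}
  {c d a : ℤ} {A : ℕ}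
  {z : ∀ (k : ℕ) (r : (cyclotomicLevelsRat p (badPlaces c d A N)).Ideals),
    H1 (tateRep W p) ((cyclotomicLevelsRat p (badPlaces c d A N)).level k r.1)}
  {x : ∀ (k : ℕ) (r : (cyclotomicLevelsRat p (badPlaces c d A N)).Ideals),
    CyclotomicField (cycLevel p k r.1) ℚ}

set_option backward.isDefEq.respectTransparency false in
/-! ### Kato's value at the bottom level -/

/-- **Kato's value at the bottom level** (steps S1–S3): from `ZetaBody` (C4) + (C5) at `k = 0`,
`r = ∅`, `χ = 1` (even): `Λ_{0,∅}(z_{0,∅}) = 1 ⊗ r₀` with `r₀ ∈ ℚ` and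
`r₀ = κ · L_{(pA)}(f,1)/Ω⁺_f · R⁻(c,d,a,A,d′)` for every entire continuation `Lχ` of the
`(pA)`-depleted series (guards `(cd, A) = 1`, `dd′ ≡ 1 (A)`).
[cite: Kato2004Asterisque, Thm. 9.7 (p. 189) and Thm. 6.6 (1) (p. 163)] -/
theorem zetaBody_value_level_one (hbody : ZetaBody W p f ι κ Λ c d a A z x) (d' : ℤ)
    (hcd : Int.gcd (c * d) A = 1) (hdd' : d * d' ≡ 1 [ZMOD (A : ℤ)])
    {Lχ : ℂ → ℂ}
    (hL : IsDepletedTwistedL f (cycLevel p 0 ∅) (p * A) (1 : DirichletCharacter ℂ (cycLevel p 0 ∅)) Lχ) :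
    ∃ r₀ : ℚ,
      algebraMap ℚ _ r₀ = x 0 (cyclotomicLevelsRat p (badPlaces c d A N)).idealOne ∧
      Λ 0 (cyclotomicLevelsRat p (badPlaces c d A N)).idealOne.1
          (z 0 (cyclotomicLevelsRat p (badPlaces c d A N)).idealOne) =
        (1 : ℚ_[p]) ⊗ₜ[ℚ] algebraMap ℚ _ r₀ ∧
      (r₀ : ℂ) = κ * (Lχ 1 / (plusPeriod f : ℂ)) * cuspFactor f true (fun _ ↦ 1) c d a A d' := by
  obtain ⟨-, -, -, -, hC4, hC5⟩ := hbody
  have h1 : cycLevel p 0 (cyclotomicLevelsRat p (badPlaces c d A N)).idealOne.1 = 1 :=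
    cycLevel_zero_empty p
  obtain ⟨r₀, hr₀⟩ := exists_algebraMap_eq_of_level_one h1
    (x 0 (cyclotomicLevelsRat p (badPlaces c d A N)).idealOne)
  refine ⟨r₀, hr₀, ?_, ?_⟩
  · rw [hr₀]
    exact hC4 0 _
  · have hgcd : Int.gcd (c * d)
        (cycLevel p 0 (cyclotomicLevelsRat p (badPlaces c d A N)).idealOne.1 * A) = 1 := by
      rw [h1, Nat.cast_one, one_mul]
      exact hcd
    have h5 := (hC5 0 _ d' 1 Lχ hgcd hdd' hL).1 (by rw [MulChar.one_apply (isUnit_one.neg)])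
    have hχ : (fun n : ℤ ↦
        (1 : DirichletCharacter ℂ (cycLevel p 0 (cyclotomicLevelsRat p (badPlaces c d A N)).idealOne.1))⁻¹
          (n : ZMod _)) = fun _ ↦ (1 : ℂ) := by
      funext n
      rw [inv_one]
      exact dirichletCharacter_apply_of_level_one h1 _ _
    rw [hχ, charSum_of_level_one h1, ← hr₀, ringHom_algebraMap] at h5
    exact h5

/-- The four-cusp factor at the trivial character is the rational number
`R⁻ = c²d²[a/A]⁻ − cd²[ac/A]⁻ − c²d[ad′/A]⁻ + cd[acd′/A]⁻` (MINUS symbols: parity cross-over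
(P1) for the even character). [cite: Kato2004Asterisque, Thm. 6.6 (1) (p. 163) and Lemma 13.10 (1) (p. 230)] -/
theorem cuspFactor_true_one (c d a : ℤ) (A : ℕ) (d' : ℤ) :
    cuspFactor f true (fun _ ↦ 1) c d a A d' =
      (((c : ℚ) ^ 2 * (d : ℚ) ^ 2 * ratMinusSymbol f ((a : ℚ) / A)
        - (c : ℚ) * (d : ℚ) ^ 2 * ratMinusSymbol f ((a * c : ℚ) / A)
        - (c : ℚ) ^ 2 * (d : ℚ) * ratMinusSymbol f ((a * d' : ℚ) / A)
        + (c : ℚ) * (d : ℚ) * ratMinusSymbol f ((a * c * d' : ℚ) / A) : ℚ) : ℂ) := by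
  simp only [cuspFactor, if_true, mul_one]
  push_cast
  ring


end Value

/-! ### Main theorem: DICT3's value clause at the empty level -/

section Main

variable {W : WeierstrassCurve ℚ} [W.IsElliptic] [W.IsGloballyMinimal] {p : ℕ} [Fact p.Prime]
  [ContinuousSMul ℤ_[p] (W.tateModule p)] [Module.Free ℤ_[p] (W.tateModule p)]
  [Module.Finite ℤ_[p] (W.tateModule p)] {N : ℕ} [NeZero N] {f : CuspForm (Gamma0 N) 2}
  {ι : (m : ℕ) → (CyclotomicField m ℚ →+* ℂ)} {κ : ℝ}
  {Λ : ∀ (k : ℕ) (r : Finset (HeightOneSpectrum (𝓞 ℚ))),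
    H1 (tateRep W p) (cycSubgroup p k r) →ₗ[ℤ_[p]] ℚ_[p] ⊗[ℚ] CyclotomicField (cycLevel p k r) ℚ}
  {c d a : ℤ} {A : ℕ}
  {z : ∀ (k : ℕ) (r : (cyclotomicLevelsRat p (badPlaces c d A N)).Ideals),
    H1 (tateRep W p) ((cyclotomicLevelsRat p (badPlaces c d A N)).level k r.1)}
  {x : ∀ (k : ℕ) (r : (cyclotomicLevelsRat p (badPlaces c d A N)).Ideals),
    CyclotomicField (cycLevel p k r.1) ℚ}

set_option backward.isDefEq.respectTransparency false in
/-- **DICT3's value clause at the EMPTY level, from `ZetaBody` + `KatoExpStarFiniteLevelAt`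
(R1-68 at `m = 1`; module docstring).**  For the class `κ₀` with `res κ₀ = Ψ(z_{0,∅})` and
`loc_v κ₀ ∈ 𝓕_can(v)`, the depletion identity `hdepl` (PK-L, displayed) and the two row
certificates (`E`, `R⁻` `p`-adic units, displayed):
`Λfin(loc_v κ₀) = u · p^t · δ̃_1`, `u ∈ (ℤ/p^{k+1})ˣ`, `δ̃_1 = kuriharaNumber f (p^(k+1)) 1 ψ = [0]⁺_f`
for every `ψ`.  Unused by design: the Manin binder and the period transfer (D-53-3).
[cite: Kim2022StructureSelmer, §1.4.3 and the proof of Thm. 3.13 (arXiv v3 pp. 26–27; = Thm. 3.11 of AJM 148)]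
[cite: Kato2004Asterisque, Thm. 9.7 (p. 189), Thm. 6.6 (1) (p. 163) and Thm. 12.5 (1) (pp. 221–222)] -/
theorem apply_localization_eq_unit_mul_kuriharaNumber_one
    (hbody : ZetaBody W p f ι κ Λ c d a A z x) (hf : IsNewformOf W f) (hp2 : p ≠ 2)
    (hirr : W.HasIrreducibleModPGaloisRep p)
    {k t : ℕ} {v : HeightOneSpectrum (𝓞 ℚ)}
    {Λfin : galoisCohomology ((W.torsionGaloisModule ((p : ℤ) ^ k * (p : ℤ))).toLocal
      (Sum.inr v)) 1 →+ ZMod (p ^ (k + 1))}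
    (hfin : KatoExpStarFiniteLevelAt W p k t v Λ Λfin)
    (hNorm : ∃ u : ℚ, (u : ℝ) = κ ∧ padicValRat p u = 0) (hκ0 : κ ≠ 0)
    (d' : ℤ) (hcd : Int.gcd (c * d) A = 1) (hdd' : d * d' ≡ 1 [ZMOD (A : ℤ)])
    {LA Lf : ℂ → ℂ}
    (hLA : IsDepletedTwistedL f (cycLevel p 0 ∅) (p * A) (1 : DirichletCharacter ℂ (cycLevel p 0 ∅)) LA)
    (hLf : Differentiable ℂ Lf) (hLf' : ∀ s : ℂ, 2 < s.re → Lf s = cuspFormLSeries f s)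
    {E : ℚ} (hdepl : LA 1 = (E : ℂ) * Lf 1) (hE0 : E ≠ 0) (hE : padicValRat p E = 0)
    (hR0 : ((c : ℚ) ^ 2 * (d : ℚ) ^ 2 * ratMinusSymbol f ((a : ℚ) / A)
        - (c : ℚ) * (d : ℚ) ^ 2 * ratMinusSymbol f ((a * c : ℚ) / A)
        - (c : ℚ) ^ 2 * (d : ℚ) * ratMinusSymbol f ((a * d' : ℚ) / A)
        + (c : ℚ) * (d : ℚ) * ratMinusSymbol f ((a * c * d' : ℚ) / A)) ≠ 0)
    (hR : padicValRat p ((c : ℚ) ^ 2 * (d : ℚ) ^ 2 * ratMinusSymbol f ((a : ℚ) / A)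
        - (c : ℚ) * (d : ℚ) ^ 2 * ratMinusSymbol f ((a * c : ℚ) / A)
        - (c : ℚ) ^ 2 * (d : ℚ) * ratMinusSymbol f ((a * d' : ℚ) / A)
        + (c : ℚ) * (d : ℚ) * ratMinusSymbol f ((a * c * d' : ℚ) / A)) = 0)
    (Ψ : H1 (tateRep W p) (cycSubgroup p 0 ∅) →+
      continuousCohomology 1
        (subgroupRep (W.torsionGaloisModule ((p : ℤ) ^ k * (p : ℤ))).toTopRep (cycSubgroup p 0 ∅)))
    (hΨ : ∀ (φ : contOneCocycles (subgroupRep (tateRep W p).toTopRep (cycSubgroup p 0 ∅)))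
        (ψ : contOneCocycles
          (subgroupRep (W.torsionGaloisModule ((p : ℤ) ^ k * (p : ℤ))).toTopRep (cycSubgroup p 0 ∅))),
        (∀ g, ((ψ.1 g : geomTorsion W ((p : ℤ) ^ k * (p : ℤ))) : geomPoints W) =
          TateModule.proj p (k + 1) (φ.1 g)) →
        Ψ (oneCocycleClass _ φ) = oneCocycleClass _ ψ)
    (κ₀ : galoisCohomology (W.torsionGaloisModule ((p : ℤ) ^ k * (p : ℤ))) 1)
    (hres : resSubgroup (W.torsionGaloisModule ((p : ℤ) ^ k * (p : ℤ))).toTopRep (cycSubgroup p 0 ∅)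
      1 κ₀ = Ψ (z 0 (cyclotomicLevelsRat p (badPlaces c d A N)).idealOne))
    (hloc : galoisCohomology.localization (W.torsionGaloisModule ((p : ℤ) ^ k * (p : ℤ))) (Sum.inr v)
      1 κ₀ ∈ propagatedSelmerStructure W p k (Sum.inr v))
    (ψ : (ℓ : ℕ) → (ZMod ℓ)ˣ →* Multiplicative (ZMod (p ^ (k + 1)))) :
    ∃ u : (ZMod (p ^ (k + 1)))ˣ,
      Λfin (galoisCohomology.localization (W.torsionGaloisModule ((p : ℤ) ^ k * (p : ℤ)))
          (Sum.inr v) 1 κ₀) =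
        (u : ZMod (p ^ (k + 1))) * (p : ZMod (p ^ (k + 1))) ^ t * kuriharaNumber f (p ^ (k + 1)) 1 ψ := by
  -- S1–S3
  obtain ⟨r₀, -, hΛ, hr₀⟩ := zetaBody_value_level_one hbody d' hcd hdd' hLA
  obtain ⟨uκ, huκ, hu⟩ := hNorm
  have huκ0 : uκ ≠ 0 := by rintro rfl; exact hκ0 (by rw [← huκ, Rat.cast_zero])
  have hQ := hf.coeffField_eq_bot
  -- S5
  have hLf1 := apply_one_eq_plusPeriod_mul_ratPlusSymbol f hf.1 hQ hLf hLf'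
  have hΩ : (plusPeriod f : ℂ) ≠ 0 := by exact_mod_cast (IsNewform0.plusPeriod_pos_holds hf.1 hQ).ne'
  set R : ℚ := (c : ℚ) ^ 2 * (d : ℚ) ^ 2 * ratMinusSymbol f ((a : ℚ) / A)
        - (c : ℚ) * (d : ℚ) ^ 2 * ratMinusSymbol f ((a * c : ℚ) / A)
        - (c : ℚ) ^ 2 * (d : ℚ) * ratMinusSymbol f ((a * d' : ℚ) / A)
        + (c : ℚ) * (d : ℚ) * ratMinusSymbol f ((a * c * d' : ℚ) / A) with hRdef
  set b : ℚ := ratPlusSymbol f 0 with hbdef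
  -- r₀ = uκ * E * R * b
  have hr₀' : r₀ = uκ * E * R * b := by
    have h : (r₀ : ℂ) = ((uκ * E * R * b : ℚ) : ℂ) := by
      rw [hr₀, cuspFactor_true_one, ← hRdef, hdepl, hLf1, ← huκ]
      push_cast
      field_simp
    exact_mod_cast h
  -- S6: integrality
  have hU0 : uκ * E * R ≠ 0 := mul_ne_zero (mul_ne_zero huκ0 hE0) hR0
  have hU : padicValRat p (uκ * E * R) = 0 := by
    rw [padicValRat.mul (mul_ne_zero huκ0 hE0) hR0, padicValRat.mul huκ0 hE0, hu, hE, hR, add_zero,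
      add_zero]
  have hb : ¬ p ∣ b.den := by
    have := hf.not_dvd_den_ratPlusSymbol_div hp2 hirr (n := 1) (Nat.coprime_one_left N) 0
    simpa using this
  have hnU := norm_ratCast_eq_one_of_padicValRat_eq_zero (p := p) hU0 hU
  set xU : ℤ_[p] := ⟨((uκ * E * R : ℚ) : ℚ_[p]), hnU.le⟩ with hxU
  set xb : ℤ_[p] := ⟨(b : ℚ_[p]), Padic.norm_rat_le_one hb⟩ with hxb
  set s : ℤ_[p] := (p : ℤ_[p]) ^ t * xU * xb with hsdef
  have hs : (s : ℚ_[p]) = (p : ℚ_[p]) ^ t * ((uκ * E * R * b : ℚ) : ℚ_[p]) := by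
    rw [hsdef]
    push_cast
    simp only [xU, xb]
    push_cast
    ring
  -- S7: the premise of (ii) with `l = 0`
  have hval : ∃ l ∈ cycIntLattice p (cycLevel p 0 ∅),
      ((p : ℤ_[p]) ^ t) • Λ 0 ∅ (z 0 (cyclotomicLevelsRat p (badPlaces c d A N)).idealOne) -
        ((s : ℚ_[p]) ⊗ₜ[ℚ] (1 : CyclotomicField (cycLevel p 0 ∅) ℚ)) =
        ((p : ℤ_[p]) ^ (k + 1)) • (l : ℚ_[p] ⊗[ℚ] CyclotomicField (cycLevel p 0 ∅) ℚ) := by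
    have hΛ' : Λ 0 ∅ (z 0 (cyclotomicLevelsRat p (badPlaces c d A N)).idealOne) =
        (1 : ℚ_[p]) ⊗ₜ[ℚ] algebraMap ℚ (CyclotomicField (cycLevel p 0 ∅) ℚ) r₀ := hΛ
    rw [hΛ']
    exact premise_of_eq (p := p) _ _ t k r₀ s (by rw [hs, hr₀'])
  -- (ii)
  have hii := hfin.2.2 ∅ Ψ hΨ _ κ₀ s hres hloc hval
  -- S8
  obtain ⟨u, hu'⟩ := exists_unit_toZModPow_eq (p := p) k t hU0 hU hb s hs
  refine ⟨u, ?_⟩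
  rw [hii, hu', kuriharaNumber_one]


end Main

end Summit.BirchSwinnertonDyer.Rank1Residual.GaloisImage.KatoValue

end
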